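import Mathlib

/-!
# The quarter-turn STRIP COUNT majorises the real row (sector majorant, kernel)

HONEST FRAMING.  Helper (seat pub-symmetroid-conjb-2 g13, cell `pub-symmetroid`, 2026-08-27) for the crux idea «quarter-turn strip count»
(evidence #49 on stmt-ValiantsHypothesis-19561, `WeakLifting`; α REAL row of record R2102/R2114 in the currency of
`…KPlusLogSqLawStaticTridiagonalDefiniteAll.le_of_definiteRow`).  The idea replaces the count of distinct positive real zeros of
`det (c i j · X ^ e i j)` by the number of complex zeros (with multiplicity) of the same determinant over `ℂ` in an open sector
`|arg z| < θ`; this file proves the one unconditional link the line needs: **for every `θ > 0` the sector count is at least the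
number of distinct positive real zeros** (`card_posRoots_le_card_sectorRoots`), for ANY real monomial matrix (no band / symmetry /
sign hypothesis is used), together with the map identity `det` over `ℂ[X]` `=` `(det` over `ℝ[X]).map` (`det_cmatrix_eq_map`).
Consequently any bound `B m` on the sector count of a family of designs is a bound on its real row (`realRow_le_of_sectorRow_le`).
Nothing here is an upper bound on either count; nothing bears on `WeakLifting` (stmt-ValiantsHypothesis-19561) in its window, `TropicalB`,
Conjecture B, the Door-A registers, `MatrixDescartes` (stmt-ValiantsHypothesis-18050) or VP ≠ VNP.  Label: calibration (structural link).
[folklore: real roots embed in complex roots; data of this seat]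
-/

set_option linter.dupNamespace false
set_option autoImplicit false

namespace Summit.ValiantsHypothesis.ValiantsHypothesis.Theorems.KPlusLogSqLaw.StripMajorant

open Polynomial Finset

/-- the complex monomial matrix is the image of the real one under `Polynomial.map`. -/
theorem cmatrix_eq_map {m : ℕ} (c : Fin m → Fin m → ℝ) (e : Fin m → Fin m → ℕ) :
    (Matrix.of fun i j => C ((c i j : ℂ)) * (X : ℂ[X]) ^ e i j)
      = (Polynomial.mapRingHom (algebraMap ℝ ℂ)).mapMatrix
          (Matrix.of fun i j => C (c i j) * (X : ℝ[X]) ^ e i j) := by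
  ext i j
  simp [Polynomial.map_mul, Polynomial.map_pow]

/-- `det` over `ℂ[X]` is the mapped `det` over `ℝ[X]`. -/
theorem det_cmatrix_eq_map {m : ℕ} (c : Fin m → Fin m → ℝ) (e : Fin m → Fin m → ℕ) :
    (Matrix.of fun i j => C ((c i j : ℂ)) * (X : ℂ[X]) ^ e i j).det
      = ((Matrix.of fun i j => C (c i j) * (X : ℝ[X]) ^ e i j).det).map (algebraMap ℝ ℂ) := by
  rw [cmatrix_eq_map, ← RingHom.map_det]
  rfl

/-- **SECTOR MAJORANT.**  For every opening `θ > 0`, the number of distinct positive real zeros of the real determinant is at most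
the number of complex zeros (with multiplicity) of the complex determinant in the open sector `|arg z| < θ`. -/
theorem card_posRoots_le_card_sectorRoots {m : ℕ} (c : Fin m → Fin m → ℝ) (e : Fin m → Fin m → ℕ)
    (θ : ℝ) (hθ : 0 < θ) :
    (((Matrix.of fun i j => C (c i j) * (X : ℝ[X]) ^ e i j).det.roots.toFinset).filter (fun t : ℝ => 0 < t)).card
      ≤ Multiset.card (((Matrix.of fun i j => C ((c i j : ℂ)) * (X : ℂ[X]) ^ e i j).det.roots).filter
          fun z => |Complex.arg z| < θ) := by
  set p : ℝ[X] := (Matrix.of fun i j => C (c i j) * (X : ℝ[X]) ^ e i j).det with hp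
  rw [det_cmatrix_eq_map, ← hp]
  by_cases hp0 : p = 0
  · simp [hp0]
  have hq0 : p.map (algebraMap ℝ ℂ) ≠ 0 := by
    rwa [Ne, Polynomial.map_eq_zero]
  -- the positive real roots inject into the sector roots via `t ↦ (t : ℂ)`
  calc (p.roots.toFinset.filter (fun t : ℝ => 0 < t)).card
      ≤ (((p.map (algebraMap ℝ ℂ)).roots.filter fun z => |Complex.arg z| < θ).toFinset).card := by
        apply Finset.card_le_card_of_injOn (fun t : ℝ => (t : ℂ))
        · intro t ht
          simp only [Finset.coe_filter, Set.mem_setOf_eq, Multiset.mem_toFinset] at ht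
          obtain ⟨hroot, hpos⟩ := ht
          simp only [Finset.mem_coe, Multiset.mem_toFinset, Multiset.mem_filter]
          refine ⟨?_, ?_⟩
          · have h1 : p.eval t = 0 := (Polynomial.mem_roots hp0).1 hroot
            rw [Polynomial.mem_roots hq0, Polynomial.IsRoot.def, Polynomial.eval_map,
              ← congrFun Complex.coe_algebraMap t, Polynomial.eval₂_hom, h1, map_zero]
          · rw [Complex.arg_ofReal_of_nonneg hpos.le, abs_zero]
            exact hθ
        · intro a _ b _ hab
          exact Complex.ofReal_injective hab
    _ ≤ Multiset.card ((p.map (algebraMap ℝ ℂ)).roots.filter fun z => |Complex.arg z| < θ) :=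
        Multiset.toFinset_card_le _

/-- Corollary in row form: a bound on the sector count of a design is a bound on its real row. -/
theorem realRow_le_of_sectorRow_le {m : ℕ} (c : Fin m → Fin m → ℝ) (e : Fin m → Fin m → ℕ)
    (θ : ℝ) (hθ : 0 < θ) (B : ℕ)
    (h : Multiset.card (((Matrix.of fun i j => C ((c i j : ℂ)) * (X : ℂ[X]) ^ e i j).det.roots).filter
          fun z => |Complex.arg z| < θ) ≤ B) :
    (((Matrix.of fun i j => C (c i j) * (X : ℝ[X]) ^ e i j).det.roots.toFinset).filter (fun t : ℝ => 0 < t)).card ≤ B :=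
  (card_posRoots_le_card_sectorRoots c e θ hθ).trans h

/-- **SECTOR MAJORANT, NONZERO FORM (APPEND 2026-08-27, conjb-2 g13).**  The form the strip-count line actually uses: the zero root
`z = 0` (whose multiplicity `ord₀ det` is unbounded in the exponents and has `arg 0 = 0`) is EXCLUDED from the sector count.  For every
opening `θ > 0`, the number of distinct positive real zeros of the real determinant is at most the number of NONZERO complex zeros (with
multiplicity) of the complex determinant in the open sector `|arg z| < θ` — i.e. the zeros of `t ↦ det F(e^t)` in the strip `|Im t| < θ`. -/
theorem card_posRoots_le_card_sectorRoots_nonzero {m : ℕ} (c : Fin m → Fin m → ℝ) (e : Fin m → Fin m → ℕ)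
    (θ : ℝ) (hθ : 0 < θ) :
    (((Matrix.of fun i j => C (c i j) * (X : ℝ[X]) ^ e i j).det.roots.toFinset).filter (fun t : ℝ => 0 < t)).card
      ≤ Multiset.card (((Matrix.of fun i j => C ((c i j : ℂ)) * (X : ℂ[X]) ^ e i j).det.roots).filter
          fun z => z ≠ 0 ∧ |Complex.arg z| < θ) := by
  set p : ℝ[X] := (Matrix.of fun i j => C (c i j) * (X : ℝ[X]) ^ e i j).det with hp
  rw [det_cmatrix_eq_map, ← hp]
  by_cases hp0 : p = 0
  · simp [hp0]
  have hq0 : p.map (algebraMap ℝ ℂ) ≠ 0 := by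
    rwa [Ne, Polynomial.map_eq_zero]
  calc (p.roots.toFinset.filter (fun t : ℝ => 0 < t)).card
      ≤ (((p.map (algebraMap ℝ ℂ)).roots.filter fun z => z ≠ 0 ∧ |Complex.arg z| < θ).toFinset).card := by
        apply Finset.card_le_card_of_injOn (fun t : ℝ => (t : ℂ))
        · intro t ht
          simp only [Finset.coe_filter, Set.mem_setOf_eq, Multiset.mem_toFinset] at ht
          obtain ⟨hroot, hpos⟩ := ht
          simp only [Finset.mem_coe, Multiset.mem_toFinset, Multiset.mem_filter]
          refine ⟨?_, ?_, ?_⟩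
          · have h1 : p.eval t = 0 := (Polynomial.mem_roots hp0).1 hroot
            rw [Polynomial.mem_roots hq0, Polynomial.IsRoot.def, Polynomial.eval_map,
              ← congrFun Complex.coe_algebraMap t, Polynomial.eval₂_hom, h1, map_zero]
          · exact_mod_cast hpos.ne'
          · rw [Complex.arg_ofReal_of_nonneg hpos.le, abs_zero]
            exact hθ
        · intro a _ b _ hab
          exact Complex.ofReal_injective hab
    _ ≤ Multiset.card ((p.map (algebraMap ℝ ℂ)).roots.filter fun z => z ≠ 0 ∧ |Complex.arg z| < θ) :=
        Multiset.toFinset_card_le _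

/-- Row form of the nonzero majorant: a bound `B` on the NONZERO sector count (= strip count of `det F(e^t)`) of a design bounds its real row. -/
theorem realRow_le_of_stripRow_le {m : ℕ} (c : Fin m → Fin m → ℝ) (e : Fin m → Fin m → ℕ)
    (θ : ℝ) (hθ : 0 < θ) (B : ℕ)
    (h : Multiset.card (((Matrix.of fun i j => C ((c i j : ℂ)) * (X : ℂ[X]) ^ e i j).det.roots).filter
          fun z => z ≠ 0 ∧ |Complex.arg z| < θ) ≤ B) :
    (((Matrix.of fun i j => C (c i j) * (X : ℝ[X]) ^ e i j).det.roots.toFinset).filter (fun t : ℝ => 0 < t)).card ≤ B :=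
  (card_posRoots_le_card_sectorRoots_nonzero c e θ hθ).trans h

/-- The nonzero sector count is at most the full sector count (dropping the conjunct `z ≠ 0`). -/
theorem card_sectorRoots_nonzero_le {m : ℕ} (c : Fin m → Fin m → ℝ) (e : Fin m → Fin m → ℕ) (θ : ℝ) :
    Multiset.card (((Matrix.of fun i j => C ((c i j : ℂ)) * (X : ℂ[X]) ^ e i j).det.roots).filter
        fun z => z ≠ 0 ∧ |Complex.arg z| < θ)
      ≤ Multiset.card (((Matrix.of fun i j => C ((c i j : ℂ)) * (X : ℂ[X]) ^ e i j).det.roots).filter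
        fun z => |Complex.arg z| < θ) := by
  apply Multiset.card_le_card
  apply Multiset.monotone_filter_right
  intro z hz
  exact hz.2

end Summit.ValiantsHypothesis.ValiantsHypothesis.Theorems.KPlusLogSqLaw.StripMajorant
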